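import Mathlib
import Summits.Ventures.PercRepro2.TypedPendantA3AtRootWeighted
import Summits.Ventures.PercRepro2.PendantBSideBound

/-!
# (HCOV) at a pendant `a₃` at a root, unconditionally (blind cell PercRepro2, mine-2 g55,
2026-08-29; `conjectures/MINE-2.md` M2-119)

`TypedPendantA3AtRootWeighted.lean` (mine-2 g54) gives the identity
`Gc p = (1 − t)·((1 − t)·Gc p₀ + t·E_{p₀}[1_Q]·B_{p₀}(Cov(1_{o∈C(a₁)}, σ_b)))` at a pendant `a₃` at
`a₂` (`t = p f`, `p₀ = p[f := 0]`), and its mirror at `a₁`.  The covariance term is the bilinear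
form of the two-copy kernel `1_Q(y)1_Q(w)(1_{o∈C₁}(y) − 1_{o∈C₁}(w))(σ_b(y) − σ_b(w))`, which
`PendantBSideBound.lean` evaluates to `2·[(P(Q)P(Q,lo,lb) − P(Q,lo)P(Q,lb)) + (P(Q,lo)P(Q,hb) −
P(Q)P(Q,lo,hb))] ≥ 0` by van den Berg–Kahn (`vdBK_pair`) and BHK 1.4 (`bhk_cross_cluster`) — one
copy, no typed hypothesis.  Hence the weighted reduction rules

  **`HCov_pendant_a3_at_a2`** / **`HCov_pendant_a3_at_a1`**:  `HCov p₀ → HCov p`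

for every admissible weight vector: (HCOV) at a pendant `a₃` at a root follows from (HCOV) with
the leaf removed.  (The typed rows of g54 needed the two-copy statements `SameCount` /
`CrossCount`; the weighted rows need only the one-copy BHK theorems.)  Own work; standard axioms.
-/

namespace Summit.Ventures.PercRepro2

namespace CovForm

namespace TypedRed

section RootRule

open Classical

variable {V : Type*} {E : Type*} [Fintype E] [DecidableEq E] [Fintype V] [DecidableEq V]
  {R : Type*} [Field R] [LinearOrder R] [IsStrictOrderedRing R]
variable (ends : E → Sym2 V) (o a₁ a₂ a₃ b : V)

/-- **(HCOV) at a pendant `a₃` at `a₂`** follows from (HCOV) with the leaf edge pinned closed,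
for every admissible weight vector. -/
theorem HCov_pendant_a3_at_a2 {f : E} (hf : ends f = s(a₃, a₂))
    (hleaf : ∀ e, a₃ ∈ ends e → e = f) (h32 : a₃ ≠ a₂) (h3o : a₃ ≠ o) (h31 : a₃ ≠ a₁)
    (h3b : a₃ ≠ b) (p : E → R) (hp : IsProbVec p)
    (h : HCov (Function.update p f 0) ends o a₁ a₂ a₃ b) : HCov p ends o a₁ a₂ a₃ b := by
  unfold HCov at h ⊢
  rw [Gc_pendant_a3_at_a2 ends o a₁ a₂ a₃ b hf hleaf h32 h3o h31 h3b p]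
  have hp0 : IsProbVec (Function.update p f 0) := hp.update f le_rfl zero_le_one
  have hB := SideBound.biForm_covKer_lo_sigma_nonneg (Function.update p f 0) hp0 ends o a₁ a₂ b
  have hQ : 0 ≤ expect (Function.update p f 0) (iQ ends a₁ a₂) := by
    rw [expect_f1]
    exact prob_nonneg hp0 _
  have ht0 := hp.nonneg f
  have ht1 : 0 ≤ 1 - p f := sub_nonneg.2 (hp.le_one f)
  exact mul_nonneg ht1 (add_nonneg (mul_nonneg ht1 h) (mul_nonneg ht0 (mul_nonneg hQ hB)))

/-- **(HCOV) at a pendant `a₃` at `a₁`** (the mirror) follows from (HCOV) with the leaf edge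
pinned closed, for every admissible weight vector. -/
theorem HCov_pendant_a3_at_a1 {f : E} (hf : ends f = s(a₃, a₁))
    (hleaf : ∀ e, a₃ ∈ ends e → e = f) (h31 : a₃ ≠ a₁) (h3o : a₃ ≠ o) (h32 : a₃ ≠ a₂)
    (h3b : a₃ ≠ b) (p : E → R) (hp : IsProbVec p)
    (h : HCov (Function.update p f 0) ends o a₁ a₂ a₃ b) : HCov p ends o a₁ a₂ a₃ b := by
  unfold HCov at h ⊢
  rw [Gc_pendant_a3_at_a1 ends o a₁ a₂ a₃ b hf hleaf h31 h3o h32 h3b p]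
  have hp0 : IsProbVec (Function.update p f 0) := hp.update f le_rfl zero_le_one
  have hB := SideBound.biForm_covKer_ho_sigma_nonneg (Function.update p f 0) hp0 ends o a₁ a₂ b
  have hQ : 0 ≤ expect (Function.update p f 0) (iQ ends a₁ a₂) := by
    rw [expect_f1]
    exact prob_nonneg hp0 _
  have ht0 := hp.nonneg f
  have ht1 : 0 ≤ 1 - p f := sub_nonneg.2 (hp.le_one f)
  exact mul_nonneg ht1 (add_nonneg (mul_nonneg ht1 h) (mul_nonneg ht0 (mul_nonneg hQ hB)))

end RootRule

end TypedRed

end CovForm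

end Summit.Ventures.PercRepro2
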